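import Summits.QuantumFields.QCD.Theses.PauliWegnerSea
import Summits.QuantumFields.QCD.Theorems.PauliWegnerSeaPhaseQuenchedFlavourDecayPionSecondMomentOfCrux
import Literature.MathematicalPhysics.QuantumFieldTheory.QCDPhaseQuenchedReweighting
import Literature.MathematicalPhysics.QuantumFieldTheory.QCDPhaseQuenchedPositivity
import Literature.MathematicalPhysics.QuantumFieldTheory.FermiFlavourPhase
import Literature.MathematicalPhysics.QuantumFieldTheory.QCDCurrentSector
import Literature.MathematicalPhysics.QuantumFieldTheory.QCDGoldstoneBound
import Summits.QuantumFields.QCD.Theorems.PauliWegnerSeaChiralOneScaleTrajectoryStubPionWickNumerator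
import Summits.QuantumFields.QCD.Theorems.PauliWegnerSeaChiralOneScaleTrajectoryStubChiralityTransfer
import Summits.QuantumFields.QCD.Theorems.PauliWegnerSeaChiralOneScaleTrajectoryTransferAE
import Summits.QuantumFields.QCD.Theorems.PauliWegnerSeaChiralOneScaleTrajectoryBridges
import Summits.QuantumFields.QCD.Theorems.PauliWegnerSeaChiralOneScaleTrajectoryLowerPinRates
import Summits.QuantumFields.QCD.Theorems.PauliWegnerSeaChiralOneScaleTrajectoryJensenPointwise
import Summits.QuantumFields.QCD.Theorems.PauliWegnerSeaChiralOneScaleTrajectorySignCoherence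

/-!
# Line `Sketch` (card one-volume-goldstone-witness assembly) — skeleton for crux
`PauliWegnerSea.ChiralOneScaleTrajectory` (stmt-QuantumFields-17512), lead prover-line-stmt-QuantumFields-17512-0

Composition: `C⁺ := Package ∧ SignedPin` (one `∃ reg`, stub `stub_packageSignedPin`, the open content) and the
TRANSFER `SignedPin → reg.IsChiralAtZero` (stub `stub_chiralityTransfer`), whose input is the un-normalised
Wick–γ₅ identity for the flavoured pion pair valid for EVERY gauge field (stub `stub_pionWickNumerator`).

* `SignedPin reg f` (inlined): for every rate `ε > 0` some positive renormalised mass `m` has, for every `C`,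
  frequently in `k`, ONE volume `S ≥ L_k` and ONE time-axis distance `n ≤ S` with
  `C e^{−ε a_k n} < ‖(∫ det D · Σ_{a,i,b,j} |G_f((0,a,i),(n e₀,b,j))|² dμ_W) / (∫ det D dμ_W)‖`
  at the DEGENERATE tuple `m_f(k) = m_crit(k) + a_k m / Z_m(k)` (signed determinant weights: for `N_f = 2`,
  `det D = (det D_t)² = |det D|` and this is the crux's own `|det|`-weighted second moment; for `N_f = 3` the
  sign rides along — kernel Sign₃ of the card is part of the package stub).
* Transfer: honest connected correlator of `A = ψ̄_g γ₅ ψ_f`, `B = ψ̄_f γ₅ ψ_g` (`pseudoscalarDensityObs`,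
  flavour-charged ⇒ one-point functions vanish, tree `IsFlavourCharged.qcdTorusExpect_onTorus`) equals
  `−(∫ det_t^{N_f−2} Σ|adj D_t|² dμ_W)/(∫ det_t^{N_f} dμ_W)` by the Wick stub; pointwise
  `det_t^{N_f−2}|adj_t|² ≥ det_t^{N_f} |G_t|²` with equality off `{det_t = 0}` (and everywhere for `N_f ≥ 3`),
  so `‖corr‖ ≥` the signed-pin quotient with no null-set input; `¬ HasLatticeMassGap ε` follows by the clause's
  own quantifier shape (`∀ C ∃ᶠ k ∃ S ∃ n`).
-/

noncomputable section

namespace Summit.QuantumFields.QCD.Cruxes.ChiralOneScaleTrajectory.GoldstoneWitness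

open scoped BigOperators
open MeasureTheory Filter
open Literature.MathematicalPhysics.QuantumFieldTheory Literature.MathematicalPhysics.QuantumLattice
  Literature.Probability.LatticeModels

/-! Stubs 1 and 2 are LANDED (imported): `stub_pionWickNumerator` (p134951,
`Theorems/PauliWegnerSeaChiralOneScaleTrajectoryStubPionWickNumerator.lean`) and `stub_chiralityTransfer`
(p134921, `…StubChiralityTransfer.lean`); the hypothesis-free transfer `chiralityTransfer_ae` (p134893,
`…TransferAE.lean`, via the tree's a.e. non-vanishing of `det D`) makes Stub 1 optional; bridges
`signedPin_of_unsignedPin_two`, `oneScaleTrajectory_of_chiralOneScaleTrajectory` (p134652) and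
`frequently_violation_of_eventual_lowerPin` (p134722) serve Stub 3. -/

/-- **Stub 3a · the `N_f = 2` package with NoCollapse, in crux currency (OPEN, held by the lead).**
A two-flavour regularisation with leading-log mass scaling and two-loop asymptotic scaling whose bare
trajectories satisfy the four clauses of the crux VERBATIM and whose clause-(iii)-type LOWER pins at the
DEGENERATE tuples `(m, m)` have no rate floor as `m → 0⁺`: for every rate `ε` some `m > 0` carries an eventual
(in `k`) lower bound `c₀ e^{-(C₁ a_k n + p log(n+1))} ≤ E₊[X^s]` for all `S ≥ L_k`, `n ≤ S`, with `C₁ < sε/2`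
("NoCollapse": `inf_m C₁(m,m)/s(m) = 0` — light quarks make light pions).  By the PROVED chain
`frequently_violation_of_eventual_lowerPin → unsignedPin_two_of_fmPin_var → signedPin_of_unsignedPin_two →
chiralityTransfer_ae` this gives `reg.IsChiralAtZero`.  It contains stmt-QuantumFields-11513 verbatim. -/
theorem stub_packageNoCollapseTwo :
    ∃ reg : QCDRegularisation 2, reg.HasMassScaling ∧ (reg.scheme 0 0 0).HasAsymptoticScaling ∧ (∀ m : Fin 2 → ℝ, (∀ f, 0 < m f) → (∀ f : Fin 2, ∀ᶠ k in atTop, -1 < reg.mcrit k + reg.a k * m f / reg.Zm k) ∧ (∀ q : ℕ, ∃ K₀ s : ℝ, 0 < s ∧ s < 1 ∧ ∀ᶠ k in atTop, ∃ ℓ₀ : ℕ, 1 ≤ ℓ₀ ∧ ℓ₀ ≤ reg.L k ∧ (ℓ₀ : ℝ) * reg.a k ≤ K₀ * (1 + |Real.log (reg.a k)|) ∧ ∀ S : ℕ, reg.L k ≤ S → ∀ (f : Fin 2) (v : Literature.Probability.LatticeModels.Site 4), v ∈ box 4 S → ‖v‖ = (ℓ₀ : ℝ) → (ℓ₀ :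 ℝ) ^ q * (1 + |reg.β k|) ^ q * ((∫ U : GaugeConfig 4 (2 * S + 1) (Matrix.specialUnitaryGroup (Fin 3) ℂ), ‖(diracMatrix U fun fl => reg.mcrit k + reg.a k * m fl / reg.Zm k).det‖ * (∑ a : Fin 3, ∑ i : Fin 4, ∑ b : Fin 3, ∑ j : Fin 4, ‖(diracMatrix U fun fl => reg.mcrit k + reg.a k * m fl / reg.Zm k)⁻¹ (quarkEquiv (f, (Torus.proj (2 * S + 1) 0, a, i))) (quarkEquiv (f, (Torus.proj (2 * S + 1) (v), b, j)))‖) ^ s ∂(wilsonMeasure (fundamentalRep (Fin 3)) (reg.β k))) / (∫ U : GaugeConfig 4 (2 * S + 1) (Matrix.specialUnitaryGroup (Fin 3) ℂ), ‖(diracMatrix U fun fl => reg.mcrit k + reg.a k * m fl / reg.Zm k).det‖ ∂(wilsonMeasure (fundamentalRep (Fin 3)) (reg.β k)))) ≤ 1) ∧ (∃ s c₀ C₁ p : ℝ, 0 < s ∧ s < 1 ∧ 0 < c₀ ∧ ∀ᶠ k in atTop, ∀ S : ℕ, reg.L k ≤ S → ∀ (f : Fin 2) (n : ℕ), n ≤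 S → c₀ * Real.exp (-(C₁ * (reg.a k * n) + p * Real.log (n + 1))) ≤ (∫ U : GaugeConfig 4 (2 * S + 1) (Matrix.specialUnitaryGroup (Fin 3) ℂ), ‖(diracMatrix U fun fl => reg.mcrit k + reg.a k * m fl / reg.Zm k).det‖ * (∑ a : Fin 3, ∑ i : Fin 4, ∑ b : Fin 3, ∑ j : Fin 4, ‖(diracMatrix U fun fl => reg.mcrit k + reg.a k * m fl / reg.Zm k)⁻¹ (quarkEquiv (f, (Torus.proj (2 * S + 1) 0, a, i))) (quarkEquiv (f, (Torus.proj (2 * S + 1) (Pi.single 0 (n : ℤ)), b, j)))‖) ^ s ∂(wilsonMeasure (fundamentalRep (Fin 3)) (reg.β k))) / (∫ U : GaugeConfig 4 (2 * S + 1) (Matrix.specialUnitaryGroup (Fin 3) ℂ), ‖(diracMatrix U fun fl => reg.mcrit k + reg.a k * m fl / reg.Zm k).det‖ ∂(wilsonMeasure (fundamentalRep (Fin 3)) (reg.β k)))) ∧ (∀ᶠ k in atTop, (1 / 2 : ℝ) ≤ ‖∫ U : GaugeConfig 4 (2 * reg.L k + 1) (Matrix.specialUnitaryGroup (Fin 3)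 ℂ), (diracMatrix U fun fl => reg.mcrit k + reg.a k * m fl / reg.Zm k).det ∂(wilsonMeasure (fundamentalRep (Fin 3)) (reg.β k))‖ / (∫ U : GaugeConfig 4 (2 * reg.L k + 1) (Matrix.specialUnitaryGroup (Fin 3) ℂ), ‖(diracMatrix U fun fl => reg.mcrit k + reg.a k * m fl / reg.Zm k).det‖ ∂(wilsonMeasure (fundamentalRep (Fin 3)) (reg.β k))))) ∧
      ∃ f g : Fin 2, f ≠ g ∧ (∀ ε : ℝ, 0 < ε → ∃ m s c₀ C₁ p : ℝ, 0 < m ∧ 0 < s ∧ s ≤ 2 ∧ 0 < c₀ ∧ C₁ < s * ε / 2 ∧ ∀ᶠ k in atTop, ∀ S : ℕ, reg.L k ≤ S → ∀ n : ℕ, n ≤ S → c₀ * Real.exp (-(C₁ * (reg.a k * n) + p * Real.log (n + 1))) ≤ (∫ U : GaugeConfig 4 (2 * S + 1) (Matrix.specialUnitaryGroup (Fin 3) ℂ), ‖(diracMatrix U fun _ : Fin 2 => reg.mcrit k + reg.a k * m / reg.Zm k).det‖ * (∑ a : Fin 3, ∑ i : Fin 4, ∑ b : Fin 3, ∑ j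 : Fin 4, ‖(diracMatrix U fun _ : Fin 2 => reg.mcrit k + reg.a k * m / reg.Zm k)⁻¹ (quarkEquiv (f, (Torus.proj (2 * S + 1) 0, a, i))) (quarkEquiv (f, (Torus.proj (2 * S + 1) (Pi.single 0 (n : ℤ)), b, j)))‖) ^ s ∂(wilsonMeasure (fundamentalRep (Fin 3)) (reg.β k))) / (∫ U : GaugeConfig 4 (2 * S + 1) (Matrix.specialUnitaryGroup (Fin 3) ℂ), ‖(diracMatrix U fun _ : Fin 2 => reg.mcrit k + reg.a k * m / reg.Zm k).det‖ ∂(wilsonMeasure (fundamentalRep (Fin 3)) (reg.β k)))) := by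
  sorry

/-- **Stub 3b · the `N_f = 3` package with NoCollapse and SIGN COHERENCE AT THE SCHEME VOLUME (OPEN, held by
the lead).**  A three-flavour regularisation with both scalings, the four package clauses VERBATIM, superlogarithmic
physical volume `a_k L_k/(1+|log a_k|) → ∞`, and, for some pair of distinct flavours: NoCollapse lower pins for the
crux's own `|det|`-weighted fractional moment at degenerate tuples (as in Stub 3a), and the card's kernel Sign₃ typed
at the ONE volume where clause (iv) lives — `θ · E₊[Σ|G_f(0, L_k e₀)|²](side 2L_k+1) ≤ ‖(∫ det D Σ|G_f|² dμ_W)/(∫ det D dμ_W)‖`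
eventually in `k`, every `m > 0`.  By `signedPin_of_lowerPins_signCoh` and `chiralityTransfer_ae` this gives
`reg.IsChiralAtZero`.  It contains stmt-QuantumFields-11513 verbatim. -/
theorem stub_packageSignCoherentThree :
    ∃ reg : QCDRegularisation 3, reg.HasMassScaling ∧ (reg.scheme 0 0 0).HasAsymptoticScaling ∧ (∀ m : Fin 3 → ℝ, (∀ f, 0 < m f) → (∀ f : Fin 3, ∀ᶠ k in atTop, -1 < reg.mcrit k + reg.a k * m f / reg.Zm k) ∧ (∀ q : ℕ, ∃ K₀ s : ℝ, 0 < s ∧ s < 1 ∧ ∀ᶠ k in atTop, ∃ ℓ₀ : ℕ, 1 ≤ ℓ₀ ∧ ℓ₀ ≤ reg.L k ∧ (ℓ₀ : ℝ) * reg.a k ≤ K₀ * (1 + |Real.log (reg.a k)|) ∧ ∀ S : ℕ, reg.L k ≤ S → ∀ (f : Fin 3) (v : Literature.Probability.LatticeModels.Site 4), v ∈ box 4 S → ‖v‖ = (ℓ₀ : ℝ) → (ℓ₀ : ℝ) ^ q * (1 + |reg.β k|) ^ q * ((∫ U : GaugeConfig 4 (2 * S + 1) (Matrix.specialUnitaryGroup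 (Fin 3) ℂ), ‖(diracMatrix U fun fl => reg.mcrit k + reg.a k * m fl / reg.Zm k).det‖ * (∑ a : Fin 3, ∑ i : Fin 4, ∑ b : Fin 3, ∑ j : Fin 4, ‖(diracMatrix U fun fl => reg.mcrit k + reg.a k * m fl / reg.Zm k)⁻¹ (quarkEquiv (f, (Torus.proj (2 * S + 1) 0, a, i))) (quarkEquiv (f, (Torus.proj (2 * S + 1) (v), b, j)))‖) ^ s ∂(wilsonMeasure (fundamentalRep (Fin 3)) (reg.β k))) / (∫ U : GaugeConfig 4 (2 * S + 1) (Matrix.specialUnitaryGroup (Fin 3) ℂ), ‖(diracMatrix U fun fl => reg.mcrit k + reg.a k * m fl / reg.Zm k).det‖ ∂(wilsonMeasure (fundamentalRep (Fin 3)) (reg.β k)))) ≤ 1) ∧ (∃ s c₀ C₁ p : ℝ, 0 < s ∧ s < 1 ∧ 0 < c₀ ∧ ∀ᶠ k in atTop, ∀ S : ℕ, reg.L k ≤ S → ∀ (f : Fin 3) (n : ℕ), n ≤ S → c₀ * Real.exp (-(C₁ * (reg.a k * n) + p * Real.log (n + 1))) ≤ (∫ U : GaugeConfig 4 (2 * S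 + 1) (Matrix.specialUnitaryGroup (Fin 3) ℂ), ‖(diracMatrix U fun fl => reg.mcrit k + reg.a k * m fl / reg.Zm k).det‖ * (∑ a : Fin 3, ∑ i : Fin 4, ∑ b : Fin 3, ∑ j : Fin 4, ‖(diracMatrix U fun fl => reg.mcrit k + reg.a k * m fl / reg.Zm k)⁻¹ (quarkEquiv (f, (Torus.proj (2 * S + 1) 0, a, i))) (quarkEquiv (f, (Torus.proj (2 * S + 1) (Pi.single 0 (n : ℤ)), b, j)))‖) ^ s ∂(wilsonMeasure (fundamentalRep (Fin 3)) (reg.β k))) / (∫ U : GaugeConfig 4 (2 * S + 1) (Matrix.specialUnitaryGroup (Fin 3) ℂ), ‖(diracMatrix U fun fl => reg.mcrit k + reg.a k * m fl / reg.Zm k).det‖ ∂(wilsonMeasure (fundamentalRep (Fin 3)) (reg.β k)))) ∧ (∀ᶠ k in atTop, (1 / 2 : ℝ) ≤ ‖∫ U : GaugeConfig 4 (2 * reg.L k + 1) (Matrix.specialUnitaryGroup (Fin 3) ℂ), (diracMatrix U fun fl => reg.mcrit k + reg.a k * m fl / reg.Zm k).det ∂(wilsonMeasure (fundamentalRep (Fin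 3)) (reg.β k))‖ / (∫ U : GaugeConfig 4 (2 * reg.L k + 1) (Matrix.specialUnitaryGroup (Fin 3) ℂ), ‖(diracMatrix U fun fl => reg.mcrit k + reg.a k * m fl / reg.Zm k).det‖ ∂(wilsonMeasure (fundamentalRep (Fin 3)) (reg.β k))))) ∧
      Tendsto (fun k => reg.a k * reg.L k / (1 + |Real.log (reg.a k)|)) atTop atTop ∧ ∃ f g : Fin 3, f ≠ g ∧ (∀ ε : ℝ, 0 < ε → ∃ m s c₀ C₁ p : ℝ, 0 < m ∧ 0 < s ∧ s ≤ 2 ∧ 0 < c₀ ∧ C₁ < s * ε / 2 ∧ ∀ᶠ k in atTop, ∀ S : ℕ, reg.L k ≤ S → ∀ n : ℕ, n ≤ S → c₀ * Real.exp (-(C₁ * (reg.a k * n) + p * Real.log (n + 1))) ≤ (∫ U : GaugeConfig 4 (2 * S + 1) (Matrix.specialUnitaryGroup (Fin 3) ℂ), ‖(diracMatrix U fun _ : Fin 3 => reg.mcrit k + reg.a k * m / reg.Zm k).det‖ * (∑ a : Fin 3, ∑ i : Fin 4, ∑ b : Fin 3, ∑ j : Fin 4, ‖(diracMatrix U fun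 _ : Fin 3 => reg.mcrit k + reg.a k * m / reg.Zm k)⁻¹ (quarkEquiv (f, (Torus.proj (2 * S + 1) 0, a, i))) (quarkEquiv (f, (Torus.proj (2 * S + 1) (Pi.single 0 (n : ℤ)), b, j)))‖) ^ s ∂(wilsonMeasure (fundamentalRep (Fin 3)) (reg.β k))) / (∫ U : GaugeConfig 4 (2 * S + 1) (Matrix.specialUnitaryGroup (Fin 3) ℂ), ‖(diracMatrix U fun _ : Fin 3 => reg.mcrit k + reg.a k * m / reg.Zm k).det‖ ∂(wilsonMeasure (fundamentalRep (Fin 3)) (reg.β k)))) ∧ (∃ θ : ℝ, 0 < θ ∧ ∀ m : ℝ, 0 < m → ∀ᶠ k in atTop, θ * ((∫ U : GaugeConfig 4 (2 * reg.L k + 1) (Matrix.specialUnitaryGroup (Fin 3) ℂ), ‖(diracMatrix U fun _ : Fin 3 => reg.mcrit k + reg.a k * m / reg.Zm k).det‖ * (∑ a : Fin 3, ∑ i : Fin 4, ∑ b : Fin 3, ∑ j : Fin 4, ‖(diracMatrix U fun _ : Fin 3 => reg.mcrit k + reg.a k * m / reg.Zm k)⁻¹ (quarkEquiv (f, (Torus.proj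 (2 * reg.L k + 1) 0, a, i))) (quarkEquiv (f, (Torus.proj (2 * reg.L k + 1) (Pi.single 0 (reg.L k : ℤ)), b, j)))‖ ^ (2 : ℕ)) ∂(wilsonMeasure (fundamentalRep (Fin 3)) (reg.β k))) / (∫ U : GaugeConfig 4 (2 * reg.L k + 1) (Matrix.specialUnitaryGroup (Fin 3) ℂ), ‖(diracMatrix U fun _ : Fin 3 => reg.mcrit k + reg.a k * m / reg.Zm k).det‖ ∂(wilsonMeasure (fundamentalRep (Fin 3)) (reg.β k)))) ≤ ‖(∫ U : GaugeConfig 4 (2 * reg.L k + 1) (Matrix.specialUnitaryGroup (Fin 3) ℂ), (diracMatrix U fun _ : Fin 3 => reg.mcrit k + reg.a k * m / reg.Zm k).det * ((∑ a : Fin 3, ∑ i : Fin 4, ∑ b : Fin 3, ∑ j : Fin 4, ‖(diracMatrix U fun _ : Fin 3 => reg.mcrit k + reg.a k * m / reg.Zm k)⁻¹ (quarkEquiv (f, (Torus.proj (2 * reg.L k + 1) 0, a, i))) (quarkEquiv (f, (Torus.proj (2 * reg.L k + 1) (Pi.single 0 (reg.L k : ℤ)), b, j)))‖ ^ (2 :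 ℕ) : ℝ) : ℂ) ∂(wilsonMeasure (fundamentalRep (Fin 3)) (reg.β k))) / (∫ U : GaugeConfig 4 (2 * reg.L k + 1) (Matrix.specialUnitaryGroup (Fin 3) ℂ), (diracMatrix U fun _ : Fin 3 => reg.mcrit k + reg.a k * m / reg.Zm k).det ∂(wilsonMeasure (fundamentalRep (Fin 3)) (reg.β k)))‖) := by
  sorry

/-- **Composition**: the two open package stubs and the landed transfer chain give the crux
`ChiralOneScaleTrajectory` BY NAME. -/
theorem ChiralOneScaleTrajectory_of :
    Summit.QuantumFields.QCD.Theses.PauliWegnerSea.ChiralOneScaleTrajectory := by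
  intro Nf hNf
  rcases hNf with rfl | rfl
  · obtain ⟨reg, hMS, hAS, hpkg, f, g, hfg, hNC⟩ := stub_packageNoCollapseTwo
    refine ⟨reg, hMS, ?_, hAS, hpkg⟩
    refine chiralityTransfer_ae 2 f g hfg reg (signedPin_of_unsignedPin_two reg f
      (unsignedPin_two_of_fmPin_var reg f fun ε hε => ?_))
    obtain ⟨m, s, c₀, C₁, p, hm, hs, hs2, hc₀, hC₁, hev⟩ := hNC ε hε
    refine ⟨s, m, hs, hs2, hm, ?_⟩
    exact frequently_violation_of_eventual_lowerPin reg.a reg.L (fun k S n =>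
      (∫ U : GaugeConfig 4 (2 * S + 1) (Matrix.specialUnitaryGroup (Fin 3) ℂ),
          ‖(diracMatrix U fun _ : Fin 2 => reg.mcrit k + reg.a k * m / reg.Zm k).det‖ *
            (∑ a : Fin 3, ∑ i : Fin 4, ∑ b : Fin 3, ∑ j : Fin 4,
              ‖(diracMatrix U fun _ : Fin 2 => reg.mcrit k + reg.a k * m / reg.Zm k)⁻¹
                  (quarkEquiv (f, (Torus.proj (2 * S + 1) 0, a, i)))
                  (quarkEquiv (f, (Torus.proj (2 * S + 1) (Pi.single 0 (n : ℤ)), b, j)))‖) ^ s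
            ∂(wilsonMeasure (fundamentalRep (Fin 3)) (reg.β k))) /
        (∫ U : GaugeConfig 4 (2 * S + 1) (Matrix.specialUnitaryGroup (Fin 3) ℂ),
          ‖(diracMatrix U fun _ : Fin 2 => reg.mcrit k + reg.a k * m / reg.Zm k).det‖
            ∂(wilsonMeasure (fundamentalRep (Fin 3)) (reg.β k))))
      c₀ C₁ p (s * ε / 2) reg.a_pos hc₀ hC₁ hev
  · obtain ⟨reg, hMS, hAS, hpkg, hvol, f, g, hfg, hNC, hSC⟩ := stub_packageSignCoherentThree
    have ha1 : ∀ᶠ k in atTop, reg.a k ≤ 1 :=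
      (reg.tendsto_a.eventually (Iio_mem_nhds one_pos)).mono fun k hk => le_of_lt hk
    exact ⟨reg, hMS, chiralityTransfer_ae 3 f g hfg reg
      (signedPin_of_lowerPins_signCoh 3 (by norm_num) reg f ha1 hvol hNC hSC), hAS, hpkg⟩

end Summit.QuantumFields.QCD.Cruxes.ChiralOneScaleTrajectory.GoldstoneWitness

end
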